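import Literature.Computability.MetaComplexity.ResolutionPlays
import HarnessLib

/-!
# Extendible families force wide resolution refutations (Atserias–Dalmau 2008, easy direction)

Topic `Literature/Computability/MetaComplexity`. The combinatorial characterisation of resolution
width of A. Atserias and V. Dalmau (*A combinatorial characterization of resolution width*,
J. Comput. Syst. Sci. 74 (2008), Thm. 2) says that a CNF `φ` has no resolution refutation of
width `≤ w` iff Duplicator wins the existential `(w+1)`-pebble game on `φ`, i.e. iff there is a
nonempty family of partial assignments, closed under sub-assignments, none of which falsifies a
clause of `φ`, with the extension property below size `w + 1`. `ResolutionPlays.lean` proves the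
HARD direction (`adGood_family`: from the width lower bound to the family). This file proves the
EASY direction, which is the one used to PROVE width lower bounds (Duplicator strategies):

* `not_falsifies_of_family` — no clause of a derivation of width `≤ w` is falsified by a member
  of such a family (induction along the derivation: an axiom by consistency, a weakening by
  monotonicity, a resolvent because the minimal falsifier of the resolvent extends by the pivot
  to a falsifier of one of the premises);
* `lt_resWidth_of_family` — hence every refutation has width `> w` (the empty clause is
  falsified by every assignment).

Partial assignments are recorded, as in `ResolutionPlays.lean`, by the finite set of literals
they make true (`Falsifies α C`: every literal of `C` is negated in `α`); no consistency of the
record is assumed (an inconsistent record only makes the hypotheses harder to meet).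

## References

* A. Atserias, V. Dalmau, J. Comput. Syst. Sci. 74 (2008) 323–334, §3, Lemma 5 / Thm. 2
  (easy direction: a winning strategy for Duplicator forbids narrow refutations)
  [AtseriasDalmau2008].
* E. Ben-Sasson, A. Wigderson, J. ACM 48 (2001), §2.2 (width) [BenSassonWigderson2001].
-/

namespace Literature.Computability.MetaComplexity

open Complexity

variable {ν : Type*} [DecidableEq ν]

/-- The minimal falsifier of a set-clause: the set of the negations of its literals. [folklore] -/
theorem falsifies_image_negate (C : Finset (Literal ν)) : Falsifies (C.image Literal.negate) C :=
  fun _ hl => Finset.mem_image_of_mem _ hl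

/-- The minimal falsifier of `C` is contained in every falsifier of `C`. [folklore] -/
theorem image_negate_subset_of_falsifies {α C : Finset (Literal ν)} (h : Falsifies α C) :
    C.image Literal.negate ⊆ α := by
  intro m hm
  obtain ⟨l, hl, rfl⟩ := Finset.mem_image.1 hm
  exact h l hl

/-- Extending the minimal falsifier of a resolvent `E = (C ∖ {v}) ∪ (D ∖ {¬v})` by `v ↦ false`
falsifies the premise `C ∋ v`. [cite: AtseriasDalmau2008, §3 (proof of Lemma 5)] -/
theorem falsifies_left_of_isResolvent {C D E : Finset (Literal ν)} {v : ν}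
    (hE : IsResolvent C D v E) {β : Finset (Literal ν)} (hβ : E.image Literal.negate ⊆ β) :
    Falsifies (insert (v, false) β) C := by
  intro l hl
  by_cases hlv : l = (v, true)
  · subst hlv
    exact Finset.mem_insert_self _ _
  · refine Finset.mem_insert_of_mem (hβ (Finset.mem_image_of_mem _ ?_))
    rw [hE.2.2]
    exact Finset.mem_union_left _ (Finset.mem_erase.2 ⟨hlv, hl⟩)

/-- Extending the minimal falsifier of a resolvent `E = (C ∖ {v}) ∪ (D ∖ {¬v})` by `v ↦ true`
falsifies the premise `D ∋ ¬v`. [cite: AtseriasDalmau2008, §3 (proof of Lemma 5)] -/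
theorem falsifies_right_of_isResolvent {C D E : Finset (Literal ν)} {v : ν}
    (hE : IsResolvent C D v E) {β : Finset (Literal ν)} (hβ : E.image Literal.negate ⊆ β) :
    Falsifies (insert (v, true) β) D := by
  intro l hl
  by_cases hlv : l = (v, false)
  · subst hlv
    exact Finset.mem_insert_self _ _
  · refine Finset.mem_insert_of_mem (hβ (Finset.mem_image_of_mem _ ?_))
    rw [hE.2.2]
    exact Finset.mem_union_right _ (Finset.mem_erase.2 ⟨hlv, hl⟩)

/-- **No narrow line is falsified by the family** (Atserias–Dalmau 2008, easy direction of
Thm. 2, as an invariant): let `H` be a family of records closed under sub-records, none of which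
falsifies a clause of `φ`, and such that every member with at most `w` literals extends, for every
variable `x`, by some value of `x` inside `H`. Then no line of a resolution derivation from `φ`
all of whose clauses have at most `w` literals is falsified by a member of `H`.
[cite: AtseriasDalmau2008, §3 Lemma 5 and Thm. 2 (easy direction)] -/
theorem not_falsifies_of_family {φ : CNF ν} {w : ℕ} {H : Set (Finset (Literal ν))}
    (hdown : ∀ α ∈ H, ∀ β ⊆ α, β ∈ H)
    (hcons : ∀ α ∈ H, ∀ c ∈ φ, ¬ Falsifies α c.toFinset)
    (hext : ∀ α ∈ H, α.card ≤ w → ∀ x : ν, ∃ b : Bool, insert (x, b) α ∈ H)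
    {π : List (ResLine ν)} (hπ : IsResDerivation φ π) (hw : resWidth π ≤ w) :
    ∀ k (hk : k < π.length), ∀ α ∈ H, ¬ Falsifies α (π[k]'hk).clause := by
  intro k
  induction k using Nat.strong_induction_on with
  | _ k ih =>
    intro hk α hα hf
    have hvalid := hπ k hk
    have hwk : (π[k]'hk).clause.card ≤ w := resWidth_le_iff.1 hw _ (List.getElem_mem hk)
    unfold IsValidResLine at hvalid
    split at hvalid
    · -- an initial clause: consistency of the family
      obtain ⟨c, hc, hcl⟩ := List.mem_map.1 hvalid
      exact hcons α hα c hc (hcl ▸ hf)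
    · -- a resolvent: extend the minimal falsifier by the pivot
      rename_i i j v _
      obtain ⟨hi, hj, hres⟩ := hvalid
      have hi' : i < k ∧ i < π.length := by simpa [List.length_take] using hi
      have hj' : j < k ∧ j < π.length := by simpa [List.length_take] using hj
      rw [List.getElem_take, List.getElem_take] at hres
      set β : Finset (Literal ν) := (π[k]'hk).clause.image Literal.negate with hβdef
      have hβα : β ⊆ α := image_negate_subset_of_falsifies hf
      have hβH : β ∈ H := hdown α hα β hβα
      have hβw : β.card ≤ w := (Finset.card_image_le).trans hwk
      obtain ⟨b, hb⟩ := hext β hβH hβw v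
      cases b with
      | false => exact ih i hi'.1 hi'.2 _ hb (falsifies_left_of_isResolvent hres subset_rfl)
      | true => exact ih j hj'.1 hj'.2 _ hb (falsifies_right_of_isResolvent hres subset_rfl)
    · -- a weakening: monotonicity
      rename_i i _
      obtain ⟨hi, hsub⟩ := hvalid
      have hi' : i < k ∧ i < π.length := by simpa [List.length_take] using hi
      rw [List.getElem_take] at hsub
      exact ih i hi'.1 hi'.2 α hα fun l hl => hf l (hsub hl)

/-- **Extendible families force wide refutations** (Atserias–Dalmau 2008, Thm. 2, easy
direction; the form used to prove width lower bounds by Duplicator strategies): if `H` is a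
nonempty family of records closed under sub-records, no member of which falsifies a clause of
`φ`, and every member with at most `w` literals extends inside `H` by some value of any variable,
then every resolution refutation of `φ` has width `> w`. [cite: AtseriasDalmau2008, Thm. 2 (easy direction)] -/
theorem lt_resWidth_of_family {φ : CNF ν} {w : ℕ} {H : Set (Finset (Literal ν))}
    (hne : H.Nonempty)
    (hdown : ∀ α ∈ H, ∀ β ⊆ α, β ∈ H)
    (hcons : ∀ α ∈ H, ∀ c ∈ φ, ¬ Falsifies α c.toFinset)
    (hext : ∀ α ∈ H, α.card ≤ w → ∀ x : ν, ∃ b : Bool, insert (x, b) α ∈ H)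
    {π : List (ResLine ν)} (hπ : IsResRefutation φ π) : w < resWidth π := by
  by_contra hw
  push Not at hw
  obtain ⟨l, hl, hl0⟩ := hπ.2
  obtain ⟨k, hk, rfl⟩ := List.getElem_of_mem hl
  obtain ⟨α, hα⟩ := hne
  exact not_falsifies_of_family hdown hcons hext hπ.1 hw k hk α hα (by rw [hl0]; intro l hl; simp at hl)

end Literature.Computability.MetaComplexity
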